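import Summits.HodgeConjecture.HodgeConjecture.Theorems.Ring2TransportDiscriminantSaturation
import HarnessLib

/-!
# Ring 2 · habitat1 (gen 55) — DISCRIMINANT SATURATION on a `K`-stable factor of ODD `K`-rank (Schoen 1998 §8, `g` odd)

HONEST FRAMING: research route conditional on HC_CM; not a corollary; Q11.4-sentence-2 already refuted in dim ≥ 3.

Cell `pub-hodge-ring2`, seat `pub-hodge-ring2-habitat1` (habitat seat 1, gen 55; markdown half: `HABITATS.md`
`## habitat1 (gen 55)` A55.1–A55.6 and `code/habitat_A/cm6powers/t58check_A/T58-HABITAT1-CHECK.md`). Pure linear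
algebra over the tree's discriminant module (`Literature.AlgebraicGeometry.Motives.weilDiscriminant`,
`bilinOrthSum`) and transport's gen-58 file `Ring2TransportDiscriminantSaturation` (p243323), which proves the power
law `disc(c E) = [c ^ dim_K V] · disc(E)` for every rank and the SATURATION for a rank-ONE summand (a `K`-line).
This file records the odd-rank case of the same printed sentence (C. Schoen, *Addendum to: Hodge classes on
self-products of a variety with an automorphism*, Compositio Math. 114 (1998), §8, p. 332): "if `g` is odd, any
element `h ∈ ℚ^×/N K^×` with `sign(h) = sign(f)` has the form `a^g f` for an appropriate choice of `a`" — for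
`[K : ℚ] = 2` squares of rationals are norms, so `[c ^ (2k+1)] = [c]`, and rescaling the form on a `K`-stable summand
of ODD `K`-rank `2k+1` (not only a `K`-line) moves the discriminant of the orthogonal sum by the class of `c`; hence
the discriminants of `(c E₁) ⊕ E₂`, `c ∈ ℚ_{>0}` (or `c` a positive integer), fill the coset `[ℚ_{>0}] · disc(E₁ ⊕ E₂)`.
USE (markdown half): the curve-free shape `X₃ × X₃′` of habitat1's CM census (two simple CM threefolds with
`K ⊂ End⁰`, `K`-ranks 3 + 3, total signature (3,3)) reaches every discriminant class, in particular the split one.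
NO abelian varieties, NO named Literature fact, NO `HC_CM` (KIND of `HC_CM` = ABSENT), 0 `def`, 0 `sorry`.

## What is here (everything PROVED)
* `mk_pow_two_mul_add_one_eq_mk` — `[c ^ (2k+1)] = [c]` in `ℚˣ ⧸ Nm(Kˣ)` for `[K : ℚ] = 2`.
* `weilDiscriminant_smul_form_of_finrank_odd_of_weil` — `disc(c E) = [c] · disc(E)` when `dim_K V` is odd.
* `weilDiscriminant_bilinOrthSum_smul_left_of_finrank_odd` — `disc((c E₁) ⊕ E₂) = [c] · disc(E₁ ⊕ E₂)` when
  `dim_K V₁` is odd.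
* `weilDiscriminant_saturation_rat_of_finrank_odd` / `weilDiscriminant_saturation_nat_of_finrank_odd` — every class
  `[q] · disc(E₁ ⊕ E₂)`, `q ∈ ℚ_{>0}`, is `disc((c E₁) ⊕ E₂)` for some rational `c > 0`, resp. some integer `c ≥ 1`.

## References
* [Schoen1998HodgeWeilAddendum] C. Schoen, Compositio Math. 114 (1998) 329–336, §8, §10.
* [vanGeemen1994HodgeAV] B. van Geemen, LNM 1594 (1994), Lemma 5.2.
* transport p243323 `Ring2TransportDiscriminantSaturation` (rank one); [Milne2021TateStandardCertainAV] Prop. 1.6.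
-/

noncomputable section

set_option linter.dupNamespace false

open Module
open scoped Matrix

namespace Summit.HodgeConjecture.HodgeConjecture.Ring2.Habitat

open Literature.AlgebraicGeometry.Motives
open Summit.HodgeConjecture.HodgeConjecture.Ring2Transport

universe u

/-! ### §1 Odd powers are the first power modulo norms from a quadratic field -/

section OddPow

variable {K : Type*} [Field K] [Algebra ℚ K]

/-- For `[K : ℚ] = 2`: `[c ^ (2k+1)] = [c]` in `ℚˣ ⧸ Nm(Kˣ)` — `c ^ (2k+1) = (c^k)^2 · c` and squares are norms
(`(c^k)^2 = Nm(c^k)`). This is the arithmetic behind Schoen 1998 §8 "if `g` is odd … `a^g f`". [folklore] -/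
theorem mk_pow_two_mul_add_one_eq_mk (hK2 : Module.finrank ℚ K = 2) (c : ℚˣ) (k : ℕ) :
    (QuotientGroup.mk (c ^ (2 * k + 1)) : ℚˣ ⧸ normUnitsSubgroup ℚ K) = QuotientGroup.mk c := by
  have hsq : (QuotientGroup.mk ((c ^ k) ^ 2) : ℚˣ ⧸ normUnitsSubgroup ℚ K) = 1 := by
    rw [QuotientGroup.eq_one_iff, ← hK2]
    exact pow_finrank_mem_normUnitsSubgroup (K := K) (c ^ k)
  rw [pow_succ, pow_mul', QuotientGroup.mk_mul, hsq, one_mul]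

end OddPow

/-! ### §2 Rescaling the form on a space of odd `K`-rank: `disc(c E) = [c] · disc(E)` -/

section SmulFormOdd

variable {K : Type*} [Field K] [Algebra ℚ K] {V : Type u} [AddCommGroup V] [Module ℚ V] [Module K V]
  [IsScalarTower ℚ K V]

/-- **Schoen 1998 §8 with `g` odd**: on a `K`-space of ODD `K`-rank (`dim_K V = 2k+1`) and `[K : ℚ] = 2`,
`disc(c E) = [c] · disc(E)` — rescaling the polarization of an odd-rank Weil pair moves its discriminant by the
class of the scaling factor (van Geemen's standing hypotheses on `(K, α, σ, E)` as in transport's rank-one version).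
[cite: Schoen1998HodgeWeilAddendum, §8] -/
theorem weilDiscriminant_smul_form_of_finrank_odd_of_weil [Module.Finite K V] (hK2 : Module.finrank ℚ K = 2)
    {k : ℕ} (hodd : Module.finrank K V = 2 * k + 1) (E : LinearMap.BilinForm ℚ V)
    {α : K} {d : ℚ} (σ : K →+* K) (hd : 0 < d) (hα : α * α = algebraMap ℚ K (-d))
    (hE : ∀ x y : V, E y x = -E x y) (hW : ∀ x y : V, E (α • x) (α • y) = d * E x y)
    (hN : E.Nondegenerate) (hσα : σ α = -α)
    (hK : ∀ k : K, ∃ a b : ℚ, k = algebraMap ℚ K a + algebraMap ℚ K b * α) (c : ℚˣ) :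
    weilDiscriminant ((c : ℚ) • E) α =
      (QuotientGroup.mk c : ℚˣ ⧸ normUnitsSubgroup ℚ K) * weilDiscriminant E α := by
  rw [weilDiscriminant_smul_form_eq_pow_mul_of_weil E σ hd hα hE hW hN hσα hK c, hodd,
    mk_pow_two_mul_add_one_eq_mk hK2 c k]

end SmulFormOdd

/-! ### §3 Orthogonal sums with a rescaled summand of odd `K`-rank -/

section OrthSumOdd

variable {K : Type*} [Field K] [Algebra ℚ K] {V₁ : Type u} {V₂ : Type u} [AddCommGroup V₁]
  [Module ℚ V₁] [Module K V₁] [AddCommGroup V₂] [Module ℚ V₂] [Module K V₂]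
  [IsScalarTower ℚ K V₁]

/-- **`disc((c E₁) ⊕ E₂) = [c] · disc(E₁ ⊕ E₂)`** when `E₁` lives on a `K`-stable summand of ODD `K`-rank
(`dim_K V₁ = 2k+1`; `k = 0` is transport's `K`-line) and `[K : ℚ] = 2`: Schoen 1998 §8 (`g` odd) + §10
(`disc` multiplicative over `ψ_A ⊕ ψ'`). [cite: Schoen1998HodgeWeilAddendum, §8 and §10 (proof of the Proposition)] -/
theorem weilDiscriminant_bilinOrthSum_smul_left_of_finrank_odd [Module.Finite K V₁] [Module.Finite K V₂]
    (hK2 : Module.finrank ℚ K = 2) {k : ℕ} (hodd : Module.finrank K V₁ = 2 * k + 1)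
    (E₁ : LinearMap.BilinForm ℚ V₁) (E₂ : LinearMap.BilinForm ℚ V₂)
    {α : K} {d : ℚ} (σ : K →+* K) (hd : 0 < d) (hα : α * α = algebraMap ℚ K (-d)) (hσα : σ α = -α)
    (hK : ∀ k : K, ∃ a b : ℚ, k = algebraMap ℚ K a + algebraMap ℚ K b * α)
    (hσ : ∀ k : K, k * σ k = algebraMap ℚ K (Algebra.norm ℚ k))
    (hE₁ : ∀ x y : V₁, E₁ y x = -E₁ x y) (hW₁ : ∀ x y : V₁, E₁ (α • x) (α • y) = d * E₁ x y)
    (hN₁ : E₁.Nondegenerate)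
    (hE₂ : ∀ x y : V₂, E₂ y x = -E₂ x y) (hW₂ : ∀ x y : V₂, E₂ (α • x) (α • y) = d * E₂ x y)
    (hN₂ : E₂.Nondegenerate) (c : ℚˣ) :
    weilDiscriminant (bilinOrthSum ((c : ℚ) • E₁) E₂) α =
      (QuotientGroup.mk c : ℚˣ ⧸ normUnitsSubgroup ℚ K) * weilDiscriminant (bilinOrthSum E₁ E₂) α := by
  have hE₁' : ∀ x y : V₁, ((c : ℚ) • E₁) y x = -((c : ℚ) • E₁) x y := fun x y => by
    simp only [LinearMap.smul_apply, smul_eq_mul, hE₁ x y, mul_neg]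
  have hW₁' : ∀ x y : V₁, ((c : ℚ) • E₁) (α • x) (α • y) = d * ((c : ℚ) • E₁) x y := fun x y => by
    simp only [LinearMap.smul_apply, smul_eq_mul, hW₁ x y]
    ring
  have hN₁' : (((c : ℚ) • E₁ : LinearMap.BilinForm ℚ V₁)).Nondegenerate :=
    nondegenerate_smul_of_ne_zero E₁ hN₁ c.ne_zero
  rw [weilDiscriminant_bilinOrthSum _ _ σ hd hα hσα hK hσ hE₁' hW₁' hN₁' hE₂ hW₂ hN₂,
    weilDiscriminant_bilinOrthSum _ _ σ hd hα hσα hK hσ hE₁ hW₁ hN₁ hE₂ hW₂ hN₂,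
    weilDiscriminant_smul_form_of_finrank_odd_of_weil hK2 hodd E₁ σ hd hα hE₁ hW₁ hN₁ hσα hK c, mul_assoc]

end OrthSumOdd

/-! ### §4 Saturation through an odd-rank summand -/

section SaturationOdd

variable {K : Type*} [Field K] [Algebra ℚ K] {V₁ : Type u} {V₂ : Type u} [AddCommGroup V₁]
  [Module ℚ V₁] [Module K V₁] [AddCommGroup V₂] [Module ℚ V₂] [Module K V₂]
  [IsScalarTower ℚ K V₁]

/-- **DISCRIMINANT SATURATION through an odd-rank summand (rational form).** `E₁` on a `K`-stable summand of odd
`K`-rank, `E₂` arbitrary (van Geemen hypotheses), `[K : ℚ] = 2`: for every `q ∈ ℚ_{>0}` the class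
`[q] · disc(E₁ ⊕ E₂)` is the discriminant of `(c E₁) ⊕ E₂` for a rational `c > 0` (namely `c = q`). For `K`
imaginary quadratic the classes `[q]`, `q > 0`, are exactly the sign-`+` classes, so every class with the sign of
`disc(E₁ ⊕ E₂)` is attained (Schoen 1998 §8: "if `g` is odd, any element `h` … with `sign(h) = sign(f)` has the
form `a^g f`"). [cite: Schoen1998HodgeWeilAddendum, §8 and §10 (proof of the Proposition)] -/
theorem weilDiscriminant_saturation_rat_of_finrank_odd [Module.Finite K V₁] [Module.Finite K V₂]
    (hK2 : Module.finrank ℚ K = 2) {k : ℕ} (hodd : Module.finrank K V₁ = 2 * k + 1)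
    (E₁ : LinearMap.BilinForm ℚ V₁) (E₂ : LinearMap.BilinForm ℚ V₂)
    {α : K} {d : ℚ} (σ : K →+* K) (hd : 0 < d) (hα : α * α = algebraMap ℚ K (-d)) (hσα : σ α = -α)
    (hK : ∀ k : K, ∃ a b : ℚ, k = algebraMap ℚ K a + algebraMap ℚ K b * α)
    (hσ : ∀ k : K, k * σ k = algebraMap ℚ K (Algebra.norm ℚ k))
    (hE₁ : ∀ x y : V₁, E₁ y x = -E₁ x y) (hW₁ : ∀ x y : V₁, E₁ (α • x) (α • y) = d * E₁ x y)
    (hN₁ : E₁.Nondegenerate)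
    (hE₂ : ∀ x y : V₂, E₂ y x = -E₂ x y) (hW₂ : ∀ x y : V₂, E₂ (α • x) (α • y) = d * E₂ x y)
    (hN₂ : E₂.Nondegenerate) (q : ℚˣ) (hq : 0 < (q : ℚ)) :
    ∃ c : ℚ, 0 < c ∧ weilDiscriminant (bilinOrthSum (c • E₁) E₂) α =
      (QuotientGroup.mk q : ℚˣ ⧸ normUnitsSubgroup ℚ K) * weilDiscriminant (bilinOrthSum E₁ E₂) α :=
  ⟨q, hq, weilDiscriminant_bilinOrthSum_smul_left_of_finrank_odd hK2 hodd E₁ E₂ σ hd hα hσα hK hσ hE₁ hW₁ hN₁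
    hE₂ hW₂ hN₂ q⟩

/-- **DISCRIMINANT SATURATION through an odd-rank summand (integer form).** Same, with the scaling factor a
positive INTEGER `a ≥ 1` (Schoen's "replacing `β` by `aβ` with `a` a positive integer" keeps a polarization a
polarization): `disc((a E₁) ⊕ E₂) = [q] · disc(E₁ ⊕ E₂)` for `a = num(q) · den(q)`.
[cite: Schoen1998HodgeWeilAddendum, §8 and §10 (proof of the Proposition)] -/
theorem weilDiscriminant_saturation_nat_of_finrank_odd [Module.Finite K V₁] [Module.Finite K V₂]
    (hK2 : Module.finrank ℚ K = 2) {k : ℕ} (hodd : Module.finrank K V₁ = 2 * k + 1)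
    (E₁ : LinearMap.BilinForm ℚ V₁) (E₂ : LinearMap.BilinForm ℚ V₂)
    {α : K} {d : ℚ} (σ : K →+* K) (hd : 0 < d) (hα : α * α = algebraMap ℚ K (-d)) (hσα : σ α = -α)
    (hK : ∀ k : K, ∃ a b : ℚ, k = algebraMap ℚ K a + algebraMap ℚ K b * α)
    (hσ : ∀ k : K, k * σ k = algebraMap ℚ K (Algebra.norm ℚ k))
    (hE₁ : ∀ x y : V₁, E₁ y x = -E₁ x y) (hW₁ : ∀ x y : V₁, E₁ (α • x) (α • y) = d * E₁ x y)
    (hN₁ : E₁.Nondegenerate)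
    (hE₂ : ∀ x y : V₂, E₂ y x = -E₂ x y) (hW₂ : ∀ x y : V₂, E₂ (α • x) (α • y) = d * E₂ x y)
    (hN₂ : E₂.Nondegenerate) (q : ℚˣ) (hq : 0 < (q : ℚ)) :
    ∃ a : ℕ, 0 < a ∧ weilDiscriminant (bilinOrthSum ((a : ℚ) • E₁) E₂) α =
      (QuotientGroup.mk q : ℚˣ ⧸ normUnitsSubgroup ℚ K) * weilDiscriminant (bilinOrthSum E₁ E₂) α := by
  obtain ⟨a, ha, ha0, hmk⟩ := exists_pos_nat_mk_eq_mk_of_pos (K := K) hK2 q hq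
  refine ⟨a, ha, ?_⟩
  rw [← hmk]
  exact weilDiscriminant_bilinOrthSum_smul_left_of_finrank_odd hK2 hodd E₁ E₂ σ hd hα hσα hK hσ hE₁ hW₁ hN₁
    hE₂ hW₂ hN₂ (Units.mk0 (a : ℚ) ha0)

/-- Consistency with transport's rank-one statement: for `dim_K V₁ = 1` (`k = 0`) the odd-rank orthogonal-sum
formula IS `Ring2Transport.weilDiscriminant_bilinOrthSum_smul_left_of_finrank_eq_one` (both sides are the same
element; recorded as an `example`, no new content). [folklore] -/
example [Module.Finite K V₁] [Module.Finite K V₂]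
    (hK2 : Module.finrank ℚ K = 2) (h1 : Module.finrank K V₁ = 1)
    (E₁ : LinearMap.BilinForm ℚ V₁) (E₂ : LinearMap.BilinForm ℚ V₂)
    {α : K} {d : ℚ} (σ : K →+* K) (hd : 0 < d) (hα : α * α = algebraMap ℚ K (-d)) (hσα : σ α = -α)
    (hK : ∀ k : K, ∃ a b : ℚ, k = algebraMap ℚ K a + algebraMap ℚ K b * α)
    (hσ : ∀ k : K, k * σ k = algebraMap ℚ K (Algebra.norm ℚ k))
    (hE₁ : ∀ x y : V₁, E₁ y x = -E₁ x y) (hW₁ : ∀ x y : V₁, E₁ (α • x) (α • y) = d * E₁ x y)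
    (hN₁ : E₁.Nondegenerate)
    (hE₂ : ∀ x y : V₂, E₂ y x = -E₂ x y) (hW₂ : ∀ x y : V₂, E₂ (α • x) (α • y) = d * E₂ x y)
    (hN₂ : E₂.Nondegenerate) (c : ℚˣ) :
    weilDiscriminant (bilinOrthSum ((c : ℚ) • E₁) E₂) α =
      (QuotientGroup.mk c : ℚˣ ⧸ normUnitsSubgroup ℚ K) * weilDiscriminant (bilinOrthSum E₁ E₂) α :=
  weilDiscriminant_bilinOrthSum_smul_left_of_finrank_odd hK2 (k := 0) (by rw [h1]) E₁ E₂ σ hd hα hσα hK hσ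
    hE₁ hW₁ hN₁ hE₂ hW₂ hN₂ c

end SaturationOdd

end Summit.HodgeConjecture.HodgeConjecture.Ring2.Habitat

end
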